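import Summits.Ventures.HodgeRepro2.T6A2ProjChart
import Mathlib.RingTheory.TensorProduct.Basic
import Mathlib.RingTheory.TensorProduct.Maps
import Mathlib.RingTheory.Localization.Away.Basic

/-!
# T6A2SegreRing — chart transitions of projective space at the ring level

Cell pub-hodge-repro2, Tier 6 (README §10), seat t6-p2 (A2 owner; gen 14, custodial). Towards a kernel
discharge of the A2 display `Hyp.Hartshorne1977_productProjective` (the Segre embedding). For the standard
grading `𝒜 = homogeneousSubmodule σ k` on `k[Xⱼ : j ∈ σ]`:
* the `k`-algebra structure on the chart ring `(k[X]_f)₀` through `(k[X])₀` (so that `Spec` of it is a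
  scheme over `Spec k` with the host's structure map), and the chart identification as a `k`-algebra
  equivalence;
* `(k[X]_{Xᵢ Xₐ})₀ = (k[X]_{Xᵢ})₀[1 / (Xₐ / Xᵢ)]` (Mathlib's `Away.isLocalization_mul`) gives
  `liftAway`: a ring map out of the chart `D₊(Xᵢ)` inverting `Xₐ / Xᵢ` extends to the overlap `D₊(Xᵢ Xₐ)`,
  and `transAway`: the induced map out of the chart `D₊(Xₐ)` (the chart transition `Xⱼ / Xₐ =
  (Xⱼ / Xᵢ) / (Xₐ / Xᵢ)`, stated without inverses as `transAway F (Xⱼ / Xₐ) · F (Xₐ / Xᵢ) = F (Xⱼ / Xᵢ)`).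
Mathlib only; no display; no `sorry`; standard axioms.
§8(d): uses an L-value-free non-vanishing device: NO.
Filed in Tier-6 WAVE 1 (2026-08-26) as p439138 (definition lane, ACCEPTED 10:53Z, commit c62f15d13aa9); this v2 differs from the filed bytes in this module docstring only (the staged-record wording dropped).
-/

namespace Summit.Ventures.HodgeRepro2.T6.A2Segre

open MvPolynomial HomogeneousLocalization Summit.Ventures.HodgeRepro2.T6.A2Surface

attribute [local instance] MvPolynomial.gradedAlgebra

universe u

section Algebra

variable (k : Type u) [CommRing k] {σ : Type u}

/-- the `k`-algebra structure on the chart ring `(k[X]_f)₀`, through `(k[X])₀`; its scalar action is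
Mathlib's `HomogeneousLocalization.instSMul` (so `r • z` is the same `•` as Mathlib's, no `SMul` diamond),
and its structure map is `fromZeroRingHom ∘ algebraMap` -/
noncomputable instance instAlgebraAway (f : MvPolynomial σ k) :
    Algebra k (Away (homogeneousSubmodule σ k) f) where
  algebraMap := (fromZeroRingHom (homogeneousSubmodule σ k) (Submonoid.powers f)).comp
    (algebraMap k (homogeneousSubmodule σ k 0))
  commutes' r z := mul_comm _ _
  smul_def' r z := by
    apply HomogeneousLocalization.val_injective
    rw [val_smul, val_mul, Algebra.smul_def r z.val,
      IsScalarTower.algebraMap_apply k (MvPolynomial σ k) (Localization (Submonoid.powers f)) r]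
    congr 1

/-- the scalar action of `instAlgebraAway` is Mathlib's `HomogeneousLocalization.instSMul` (definitionally) -/
theorem instAlgebraAway_toSMul (f : MvPolynomial σ k) :
    (instAlgebraAway k f).toSMul = HomogeneousLocalization.instSMul (Submonoid.powers f) := rfl

/-- the structure map `k → (k[X]_f)₀` is `fromZeroRingHom ∘ algebraMap` -/
theorem algebraMap_away (f : MvPolynomial σ k) :
    algebraMap k (Away (homogeneousSubmodule σ k) f) =
      (fromZeroRingHom (homogeneousSubmodule σ k) (Submonoid.powers f)).comp
        (algebraMap k (homogeneousSubmodule σ k 0)) := rfl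

/-- on the chart `D₊(Xᵢ)` the structure map from `k` is `chartAlgebraMap` -/
theorem algebraMap_away_X (i : σ) :
    algebraMap k (Away (homogeneousSubmodule σ k) (X i)) = chartAlgebraMap k i := rfl

/-- `toChart` (`Xⱼ ↦ Xⱼ / Xᵢ`) as a `k`-algebra map -/
noncomputable def toChartₐ (i : σ) :
    MvPolynomial σ k →ₐ[k] Away (homogeneousSubmodule σ k) (X i) :=
  aeval (chartCoord k i)

/-- `toChartₐ` is `toChart` on elements -/
theorem toChartₐ_apply (i : σ) (p : MvPolynomial σ k) : toChartₐ k i p = toChart k i p := rfl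

/-- the chart identification `k[Xⱼ / Xᵢ : j ≠ i] ≃ (k[X]_{Xᵢ})₀` as a `k`-algebra equivalence -/
noncomputable def chartAlgEquiv [DecidableEq σ] (i : σ) :
    MvPolynomial {j // j ≠ i} k ≃ₐ[k] Away (homogeneousSubmodule σ k) (X i) :=
  AlgEquiv.ofRingEquiv (f := chartEquiv k i) fun r => by
    rw [chartEquiv_apply, MvPolynomial.algebraMap_eq, toChart'_C]
    rfl

/-- `chartAlgEquiv` is `chartEquiv` on elements -/
theorem chartAlgEquiv_apply [DecidableEq σ] (i : σ) (p : MvPolynomial {j // j ≠ i} k) :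
    chartAlgEquiv k i p = chartEquiv k i p := rfl

/-- the chart identification sends `Xⱼ / Xᵢ` (`j ≠ i`) back to the variable `Xⱼ` -/
theorem chartAlgEquiv_symm_chartCoord [DecidableEq σ] (i : σ) {j : σ} (h : j ≠ i) :
    (chartAlgEquiv k i).symm (chartCoord k i j) = X ⟨j, h⟩ := by
  rw [AlgEquiv.symm_apply_eq, chartAlgEquiv_apply, chartEquiv_apply, toChart'_X]

/-- two ring maps out of the chart ring `(k[X]_{Xᵢ})₀` agreeing on `k` and on the coordinates
`Xⱼ / Xᵢ` are equal -/
theorem ringHom_ext_away {R : Type*} [CommRing R] (i : σ)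
    {F G : Away (homogeneousSubmodule σ k) (X i) →+* R}
    (hC : ∀ r, F (chartAlgebraMap k i r) = G (chartAlgebraMap k i r))
    (hX : ∀ j, F (chartCoord k i j) = G (chartCoord k i j)) : F = G := by
  have h : F.comp (toChart k i) = G.comp (toChart k i) := by
    apply MvPolynomial.ringHom_ext
    · intro r
      simpa [toChart_C] using hC r
    · intro j
      simpa [toChart_X] using hX j
  ext z
  obtain ⟨p, rfl⟩ := toChart_surjective k i z
  exact DFunLike.congr_fun h p

end Algebra

section Overlap

variable {k : Type u} [CommRing k] {σ : Type u}

/-- the element `p / (f g)` of `(k[X]_{fg})₀`, for `f g` of degree `1` and `p` of degree `2` -/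
noncomputable def mk2 {f g : MvPolynomial σ k} (hf : f ∈ homogeneousSubmodule σ k 1)
    (hg : g ∈ homogeneousSubmodule σ k 1) (p : MvPolynomial σ k)
    (hp : p ∈ homogeneousSubmodule σ k 2) : Away (homogeneousSubmodule σ k) (f * g) :=
  Away.mk _ (SetLike.mul_mem_graded hf hg) 1 p (by rw [one_nsmul]; exact hp)

/-- the value of `mk2` in the ordinary localisation -/
theorem val_mk2 {f g : MvPolynomial σ k} (hf : f ∈ homogeneousSubmodule σ k 1)
    (hg : g ∈ homogeneousSubmodule σ k 1) (p : MvPolynomial σ k)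
    (hp : p ∈ homogeneousSubmodule σ k 2) :
    (mk2 hf hg p hp).val = Localization.mk p ⟨(f * g) ^ 1, by use 1⟩ := rfl

/-- `(h f / fg) · (g g / fg) = h g / fg` -/
theorem mk2_mul_mk2 {f g h : MvPolynomial σ k} (hf : f ∈ homogeneousSubmodule σ k 1)
    (hg : g ∈ homogeneousSubmodule σ k 1) (hh : h ∈ homogeneousSubmodule σ k 1) :
    mk2 hf hg (h * f) (SetLike.mul_mem_graded hh hf) *
        mk2 hf hg (g * g) (SetLike.mul_mem_graded hg hg) =
      mk2 hf hg (h * g) (SetLike.mul_mem_graded hh hg) := by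
  apply HomogeneousLocalization.val_injective
  rw [val_mul, val_mk2, val_mk2, val_mk2, Localization.mk_mul, Localization.mk_eq_mk_iff,
    Localization.r_iff_exists]
  exact ⟨1, by simp only [OneMemClass.coe_one, one_mul, Submonoid.coe_mul]; ring⟩

/-- `Xⱼ / Xᵢ ↦ Xⱼ Xₐ / (Xᵢ Xₐ)` under the restriction `D₊(Xᵢ Xₐ) ⊂ D₊(Xᵢ)` -/
theorem awayMap_chartCoord (i a j : σ) :
    awayMap (homogeneousSubmodule σ k) (X_mem_homogeneousSubmodule_one k a)
        (rfl : X i * X a = X i * X a) (chartCoord k i j) =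
      mk2 (X_mem_homogeneousSubmodule_one k i) (X_mem_homogeneousSubmodule_one k a) (X j * X a)
        (SetLike.mul_mem_graded (X_mem_homogeneousSubmodule_one k j)
          (X_mem_homogeneousSubmodule_one k a)) := by
  apply HomogeneousLocalization.val_injective
  rw [chartCoord, awayMap_mk, Away.val_mk, val_mk2, Localization.mk_eq_mk_iff,
    Localization.r_iff_exists]
  exact ⟨1, by simp only [OneMemClass.coe_one, one_mul, pow_one]⟩

/-- `Xⱼ / Xₐ ↦ Xⱼ Xᵢ / (Xᵢ Xₐ)` under the restriction `D₊(Xᵢ Xₐ) ⊂ D₊(Xₐ)` -/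
theorem awayMap'_chartCoord (i a j : σ) :
    awayMap (homogeneousSubmodule σ k) (X_mem_homogeneousSubmodule_one k i)
        (mul_comm (X i) (X a)) (chartCoord k a j) =
      mk2 (X_mem_homogeneousSubmodule_one k i) (X_mem_homogeneousSubmodule_one k a) (X j * X i)
        (SetLike.mul_mem_graded (X_mem_homogeneousSubmodule_one k j)
          (X_mem_homogeneousSubmodule_one k i)) := by
  apply HomogeneousLocalization.val_injective
  rw [chartCoord, awayMap_mk, Away.val_mk, val_mk2, Localization.mk_eq_mk_iff,
    Localization.r_iff_exists]
  exact ⟨1, by simp only [OneMemClass.coe_one, one_mul, pow_one]⟩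

/-- the localising element of `(k[X]_{Xᵢ Xₐ})₀ = (k[X]_{Xᵢ})₀[1 / t]` is the coordinate `t = Xₐ / Xᵢ` -/
theorem isLocalizationElem_eq (i a : σ) :
    Away.isLocalizationElem (X_mem_homogeneousSubmodule_one k i)
        (X_mem_homogeneousSubmodule_one k a) = chartCoord k i a := by
  apply HomogeneousLocalization.val_injective
  rw [Away.isLocalizationElem, chartCoord, Away.val_mk, Away.val_mk, Localization.mk_eq_mk_iff,
    Localization.r_iff_exists]
  exact ⟨1, by simp only [OneMemClass.coe_one, one_mul, pow_one]⟩

variable (k)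

/-- a ring map out of the chart `D₊(Xᵢ)` inverting `Xₐ / Xᵢ` extends to the overlap `D₊(Xᵢ Xₐ)` -/
noncomputable def liftAway (i a : σ) {R : Type*} [CommRing R]
    (F : Away (homogeneousSubmodule σ k) (X i) →+* R) (hF : IsUnit (F (chartCoord k i a))) :
    Away (homogeneousSubmodule σ k) (X i * X a) →+* R :=
  letI := (awayMap (homogeneousSubmodule σ k) (X_mem_homogeneousSubmodule_one k a)
    (rfl : X i * X a = X i * X a)).toAlgebra
  haveI := Away.isLocalization_mul (X_mem_homogeneousSubmodule_one k i)
    (X_mem_homogeneousSubmodule_one k a) (rfl : X i * X a = X i * X a) one_ne_zero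
  IsLocalization.Away.lift (Away.isLocalizationElem (X_mem_homogeneousSubmodule_one k i)
    (X_mem_homogeneousSubmodule_one k a)) (g := F) (by rwa [isLocalizationElem_eq])

/-- `liftAway F` extends `F` along `D₊(Xᵢ Xₐ) ⊂ D₊(Xᵢ)` -/
theorem liftAway_awayMap (i a : σ) {R : Type*} [CommRing R]
    (F : Away (homogeneousSubmodule σ k) (X i) →+* R) (hF : IsUnit (F (chartCoord k i a)))
    (z : Away (homogeneousSubmodule σ k) (X i)) :
    liftAway k i a F hF (awayMap (homogeneousSubmodule σ k) (X_mem_homogeneousSubmodule_one k a)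
      (rfl : X i * X a = X i * X a) z) = F z := by
  letI := (awayMap (homogeneousSubmodule σ k) (X_mem_homogeneousSubmodule_one k a)
    (rfl : X i * X a = X i * X a)).toAlgebra
  haveI := Away.isLocalization_mul (X_mem_homogeneousSubmodule_one k i)
    (X_mem_homogeneousSubmodule_one k a) (rfl : X i * X a = X i * X a) one_ne_zero
  exact IsLocalization.Away.lift_eq _ _ z

/-- `liftAway F ∘ awayMap = F` -/
theorem liftAway_comp_awayMap (i a : σ) {R : Type*} [CommRing R]
    (F : Away (homogeneousSubmodule σ k) (X i) →+* R) (hF : IsUnit (F (chartCoord k i a))) :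
    (liftAway k i a F hF).comp (awayMap (homogeneousSubmodule σ k)
      (X_mem_homogeneousSubmodule_one k a) (rfl : X i * X a = X i * X a)) = F :=
  RingHom.ext (liftAway_awayMap k i a F hF)

/-- `liftAway F` agrees with `F` on `k` -/
theorem liftAway_algebraMap (i a : σ) {R : Type*} [CommRing R]
    (F : Away (homogeneousSubmodule σ k) (X i) →+* R) (hF : IsUnit (F (chartCoord k i a)))
    (r : k) :
    liftAway k i a F hF (algebraMap k _ r) = F (algebraMap k _ r) := by
  rw [algebraMap_away, RingHom.comp_apply,
    ← awayMap_fromZeroRingHom (homogeneousSubmodule σ k) (X_mem_homogeneousSubmodule_one k a)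
      (rfl : X i * X a = X i * X a), liftAway_awayMap]
  rfl

/-- the chart transition: the map out of the chart `D₊(Xₐ)` induced by a map out of `D₊(Xᵢ)`
inverting `Xₐ / Xᵢ` (through the overlap `D₊(Xᵢ Xₐ)`) -/
noncomputable def transAway (i a : σ) {R : Type*} [CommRing R]
    (F : Away (homogeneousSubmodule σ k) (X i) →+* R) (hF : IsUnit (F (chartCoord k i a))) :
    Away (homogeneousSubmodule σ k) (X a) →+* R :=
  (liftAway k i a F hF).comp (awayMap (homogeneousSubmodule σ k)
    (X_mem_homogeneousSubmodule_one k i) (mul_comm (X i) (X a)))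

/-- `transAway F` is `liftAway F` after the restriction `D₊(Xᵢ Xₐ) ⊂ D₊(Xₐ)` -/
theorem transAway_apply (i a : σ) {R : Type*} [CommRing R]
    (F : Away (homogeneousSubmodule σ k) (X i) →+* R) (hF : IsUnit (F (chartCoord k i a)))
    (z : Away (homogeneousSubmodule σ k) (X a)) :
    transAway k i a F hF z = liftAway k i a F hF (awayMap (homogeneousSubmodule σ k)
      (X_mem_homogeneousSubmodule_one k i) (mul_comm (X i) (X a)) z) := rfl

/-- `transAway F (Xⱼ / Xₐ) · F (Xₐ / Xᵢ) = F (Xⱼ / Xᵢ)` -/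
theorem transAway_chartCoord_mul (i a j : σ) {R : Type*} [CommRing R]
    (F : Away (homogeneousSubmodule σ k) (X i) →+* R) (hF : IsUnit (F (chartCoord k i a))) :
    transAway k i a F hF (chartCoord k a j) * F (chartCoord k i a) = F (chartCoord k i j) := by
  rw [transAway_apply, ← liftAway_awayMap k i a F hF (chartCoord k i a), ← map_mul,
    awayMap'_chartCoord, awayMap_chartCoord,
    mk2_mul_mk2 (X_mem_homogeneousSubmodule_one k i) (X_mem_homogeneousSubmodule_one k a)
      (X_mem_homogeneousSubmodule_one k j), ← awayMap_chartCoord, liftAway_awayMap]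

/-- `transAway F` agrees with `F` on `k` -/
theorem transAway_algebraMap (i a : σ) {R : Type*} [CommRing R]
    (F : Away (homogeneousSubmodule σ k) (X i) →+* R) (hF : IsUnit (F (chartCoord k i a)))
    (r : k) :
    transAway k i a F hF (algebraMap k _ r) = F (algebraMap k _ r) := by
  rw [transAway_apply, algebraMap_away, RingHom.comp_apply, awayMap_fromZeroRingHom,
    ← liftAway_algebraMap k i a F hF r, algebraMap_away, RingHom.comp_apply]

/-- `transAway` as a `k`-algebra map -/
noncomputable def transAwayₐ (i a : σ) {R : Type*} [CommRing R] [Algebra k R]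
    (F : Away (homogeneousSubmodule σ k) (X i) →ₐ[k] R) (hF : IsUnit (F (chartCoord k i a))) :
    Away (homogeneousSubmodule σ k) (X a) →ₐ[k] R where
  __ := transAway k i a F.toRingHom hF
  commutes' r := by
    change transAway k i a F.toRingHom hF (algebraMap k _ r) = algebraMap k R r
    rw [transAway_algebraMap]
    exact F.commutes r

/-- `transAwayₐ` is `transAway` on elements -/
theorem transAwayₐ_apply (i a : σ) {R : Type*} [CommRing R] [Algebra k R]
    (F : Away (homogeneousSubmodule σ k) (X i) →ₐ[k] R) (hF : IsUnit (F (chartCoord k i a)))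
    (z : Away (homogeneousSubmodule σ k) (X a)) :
    transAwayₐ k i a F hF z = transAway k i a F.toRingHom hF z := rfl

end Overlap

end Summit.Ventures.HodgeRepro2.T6.A2Segre
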